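/-
Copyright (c) 2026. All rights reserved.
Released under Apache 2.0 license as described in the file LICENSE.
-/
import Literature.NumberTheory.Automorphic.BrandtModuleRamifiedSignSpaceDimension
import HarnessLib

/-!
# `2^{ω(M)} dim M^χ(O) = ∑_{d ∣ M} χ(d) #{[I] : O_L(I) ∋ x, nrd x = d}` over the divisors of `M = ∏_{q ∈ T} q`, and the
# equidistribution criterion: the sign patterns at the ramified primes `T` are equidistributed in `M(O)` iff no left order
# `O_L(I)` represents a divisor `d > 1` of `M` (Martin 2018, Prop. 12 / Cor. 8 with Eichler's traces)

[tag: quaternion_algebra] [tag: eichler_order] [tag: hecke_operator]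

Topic `NumberTheory/Automorphic`. Lane `lit-hodgefound`, seat p12, gen 52 — sequel of
`BrandtModuleRamifiedSignSpaceDimension.lean` (`2^{#T} dim M^χ(O) = ∑_{g ∈ (ℤ/2ℤ)^T} χ(g) #{c : O_L(I_c) ∋ x, nrd x = d_g}`,
indexed by the sign group) and `QuaternionicSIdealClassesAdmissible.lean` (Cor. 8: all `T`-classes are `χ`-admissible for
all `χ` iff `dim M^χ(O)` is independent of `χ` iff the `Φ_T(g)`, `g ≠ 1`, have no fixed class).

For a Brandt setup `S` (an Eichler order `O` of level `N⁺` in the definite quaternion algebra of discriminant `N⁻` over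
`ℚ`) and a set `T` of primes of `N⁻`, put `M = M_T = ∏_{q ∈ T} q` (a squarefree divisor of `N⁻`). The printed shape of
Martin's formula [Martin2018RefinedDimensions, §3 Prop. 12], `dim S^{new,ε_M} = 2^{−ω(M)} ∑_{d ∣ M} ε_M(d) tr W_d`, indexes
the sum by the DIVISORS of `M`; §1 identifies the sign group `(ℤ/2ℤ)^T` with the divisors of `M` (`g ↦ d_g`), §2 restates
the dimension formula and the `T`-ideal class number over `d ∣ M`, and §3 turns Cor. 8 into arithmetic:

* §1 `dvd_divisorOf_iff` (`r ∣ d_g ⟺ g_r ≠ 0`), **`divisorOf_injective`**, `prod_dvd_of_subset_primeFactors` (`M ∣ N⁻`),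
  `squarefree_prod_of_subset_primeFactors`, `divisorOf_mem_divisors`, **`exists_divisorOf_eq`** (every `d ∣ M` is a `d_g`),
  **`sum_divisors_prod_eq_sum`** (`∑_{d ∣ M} F(d) = ∑_g F(d_g)`);
* §2 ★ **`two_pow_mul_finrank_signSpace_eq_sum_divisors`** (`2^{#T} dim M^χ(O) = ∑_{d ∣ M} χ(d) · #{c : O_L(I_c) ∋ x, nrd x = d}`
  with `χ(d) = ∏_{q ∈ T, q ∣ d} χ_q` — the formula AS PRINTED, for every Eichler level `N⁺`),
  ★ **`two_pow_mul_natCard_sClassSet_eq_sum_divisors`** (`2^{#T} h_T = ∑_{d ∣ M} #{c : O_L(I_c) ∋ x, nrd x = d}`; at `T` = all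
  primes of `N⁻`, `N⁺ = 1` this is `two_pow_mul_natCard_typeSet_eq_sum_natCard` of `BrandtMatrixRamifiedDivisors`);
* §3 ★★ **`forall_finrank_signSpace_eq_iff_forall_not_exists_reducedNorm`** (EQUIDISTRIBUTION CRITERION: `dim M^χ(O)` is
  independent of `χ` — equivalently every `T`-class is `χ`-admissible for every `χ`, Cor. 8 — iff for every divisor
  `1 < d ∣ M` NO left order `O_L(I_c)`, `[I_c] ∈ Cls O`, contains an element of reduced norm `d`), and then
  `finrank_signSpace_mul_two_pow_eq_of_forall_not_exists_reducedNorm` (`2^{#T} dim M^χ(O) = h` for every `χ`),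
  `natCard_sClassSet_mul_two_pow_eq_of_forall_not_exists_reducedNorm` (`2^{#T} h_T = h`).

## References

* [Martin2018RefinedDimensions] K. Martin, *Refined dimensions of cusp forms, and equidistribution and bias of signs*,
  J. Number Theory 188 (2018), §3 Lemma 11, Prop. 12.
* [Martin2018] K. Martin, *Congruences for modular forms mod 2 and quaternionic `S`-ideal classes*, Canad. J. Math. 70
  (2018): §2, §4.4 Cor. 8, §4.5 (`σ_𝔭` acts freely iff no fixed points).
* [VignerasLNM800] M.-F. Vignéras, *Arithmétique des algèbres de quaternions*, LNM 800 (1980), Ch. V §2 (traces of the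
  Brandt matrices).
* [Voight2021] J. Voight, *Quaternion Algebras*, GTM 288 (2021): (30.9.3).

## Scope (honest)

`T ⊆` primes of `N⁻` only (the level involutions `W_{p⁺}` are not counted by reduced norms); weight `0`, `F = ℚ`. Theorems
only; no definition, no named fact, no instance.
-/

noncomputable section

open scoped Pointwise

namespace Literature.NumberTheory.Automorphic

namespace Brandt

/-! ## §1 The sign group `(ℤ/2ℤ)^T` and the divisors of `M_T = ∏_{q ∈ T} q` -/

section Divisors

variable (T : Finset ℕ) {Nminus : ℕ} (hN : Squarefree Nminus) (hT : T ⊆ Nminus.primeFactors)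

/-- The two elements of `ℤ/2ℤ` (multiplicative notation). [folklore] -/
private theorem eq_one_or_eq_ofAdd_one₅ (z : Multiplicative (ZMod 2)) : z = 1 ∨ z = Multiplicative.ofAdd 1 := by
  revert z; decide

/-- `ofAdd 1 ≠ 1` in `ℤ/2ℤ`. [folklore] -/
private theorem ofAdd_one_ne_one₅ : Multiplicative.ofAdd (1 : ZMod 2) ≠ 1 := by decide

include hT in
/-- Members of `T` are prime. [folklore] -/
private theorem prime_of_mem₅ {r : ℕ} (hr : r ∈ T) : r.Prime :=
  Nat.prime_of_mem_primeFactors (hT hr)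

include hT in
/-- **`r ∣ d_g ⟺ g_r ≠ 0`** for `r ∈ T` (`T` a set of primes). [cite: Martin2018RefinedDimensions, §3 Prop. 12 (divisors `d ∣ M` ↔ subsets of the primes of `M`)] -/
theorem dvd_divisorOf_iff (g : T → Multiplicative (ZMod 2)) (r : T) : (r : ℕ) ∣ divisorOf T g ↔ g r ≠ 1 := by
  rw [divisorOf_apply]
  constructor
  · intro h
    obtain ⟨i, -, hi⟩ := ((prime_of_mem₅ T hT r.2).prime.dvd_finsetProd_iff _).mp h
    by_cases hgi : g i = 1
    · rw [if_pos hgi] at hi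
      exact absurd (Nat.dvd_one.mp hi) (prime_of_mem₅ T hT r.2).ne_one
    · rw [if_neg hgi] at hi
      have e : (r : ℕ) = i := (Nat.prime_dvd_prime_iff_eq (prime_of_mem₅ T hT r.2) (prime_of_mem₅ T hT i.2)).mp hi
      rwa [Subtype.ext e]
  · intro h
    have e : (if g r = 1 then 1 else (r : ℕ)) = r := if_neg h
    calc (r : ℕ) = (if g r = 1 then 1 else (r : ℕ)) := e.symm
      _ ∣ ∏ i : T, (if g i = 1 then 1 else (i : ℕ)) := Finset.dvd_prod_of_mem _ (Finset.mem_univ r)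

include hT in
/-- **`g ↦ d_g` is injective** on the sign group. [cite: Martin2018RefinedDimensions, §3 Prop. 12] -/
theorem divisorOf_injective : Function.Injective (divisorOf T) := by
  intro g g' h
  funext r
  have key : g r ≠ 1 ↔ g' r ≠ 1 := by
    rw [← dvd_divisorOf_iff T hT g r, ← dvd_divisorOf_iff T hT g' r, h]
  rcases eq_one_or_eq_ofAdd_one₅ (g r) with a | a <;> rcases eq_one_or_eq_ofAdd_one₅ (g' r) with b | b
  · rw [a, b]
  · exact absurd a (key.mpr (by rw [b]; exact ofAdd_one_ne_one₅))
  · exact absurd b (key.mp (by rw [a]; exact ofAdd_one_ne_one₅))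
  · rw [a, b]

include hN hT in
/-- `M_T = ∏_{q ∈ T} q` divides `N⁻`. [cite: Martin2018, §2 (`𝔐 ∣ 𝔑`)] -/
theorem prod_dvd_of_subset_primeFactors : ∏ q ∈ T, q ∣ Nminus := by
  refine (Finset.prod_dvd_prod_of_subset _ _ _ hT).trans ?_
  rw [Nat.prod_primeFactors_of_squarefree hN]

include hN hT in
/-- `M_T` is squarefree. [cite: Martin2018RefinedDimensions, §3 (`M` squarefree)] -/
theorem squarefree_prod_of_subset_primeFactors : Squarefree (∏ q ∈ T, q) :=
  Squarefree.squarefree_of_dvd (prod_dvd_of_subset_primeFactors T hN hT) hN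

/-- `d_g ∣ M_T`. [folklore] -/
private theorem divisorOf_dvd_prod₅ (g : T → Multiplicative (ZMod 2)) : divisorOf T g ∣ ∏ q ∈ T, q := by
  rw [divisorOf_apply, ← Finset.prod_coe_sort T]
  exact Finset.prod_dvd_prod_of_dvd _ _ fun r _ => by
    split_ifs
    · exact one_dvd _
    · exact dvd_rfl

include hN hT in
/-- `d_g` is a divisor of `M_T`. [cite: Martin2018RefinedDimensions, §3 Prop. 12] -/
theorem divisorOf_mem_divisors (g : T → Multiplicative (ZMod 2)) : divisorOf T g ∈ (∏ q ∈ T, q).divisors :=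
  Nat.mem_divisors.mpr ⟨divisorOf_dvd_prod₅ T g, (squarefree_prod_of_subset_primeFactors T hN hT).ne_zero⟩

include hN hT in
/-- **Every divisor `d ∣ M_T` is `d_g` for the indicator `g` of its prime factors.** [cite: Martin2018RefinedDimensions, §3 Prop. 12] -/
theorem exists_divisorOf_eq {d : ℕ} (hd : d ∣ ∏ q ∈ T, q) : ∃ g : T → Multiplicative (ZMod 2), divisorOf T g = d := by
  classical
  have hd0 : Squarefree d := Squarefree.squarefree_of_dvd hd (squarefree_prod_of_subset_primeFactors T hN hT)
  refine ⟨fun r => if (r : ℕ) ∣ d then Multiplicative.ofAdd 1 else 1, ?_⟩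
  rw [divisorOf_apply]
  have e1 : ∀ r : T, (if (if (r : ℕ) ∣ d then Multiplicative.ofAdd (1 : ZMod 2) else 1) = 1 then 1 else (r : ℕ)) =
      if (r : ℕ) ∣ d then (r : ℕ) else 1 := fun r => by
    by_cases h : (r : ℕ) ∣ d
    · rw [if_pos h, if_neg ofAdd_one_ne_one₅, if_pos h]
    · rw [if_neg h, if_pos rfl, if_neg h]
  rw [Finset.prod_congr rfl fun r _ => e1 r, Finset.prod_coe_sort T fun q => if q ∣ d then q else 1,
    ← Finset.prod_filter]
  have hpf : T.filter (· ∣ d) = d.primeFactors := by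
    ext q
    rw [Finset.mem_filter, Nat.mem_primeFactors_of_ne_zero hd0.ne_zero]
    constructor
    · rintro ⟨hq, hqd⟩
      exact ⟨prime_of_mem₅ T hT hq, hqd⟩
    · rintro ⟨hq, hqd⟩
      refine ⟨?_, hqd⟩
      obtain ⟨i, hi, hqi⟩ := (hq.prime.dvd_finsetProd_iff _).mp (hqd.trans hd)
      rwa [(Nat.prime_dvd_prime_iff_eq hq (prime_of_mem₅ T hT hi)).mp hqi]
  rw [hpf, Nat.prod_primeFactors_of_squarefree hd0]

include hN hT in
/-- **`∑_{d ∣ M_T} F(d) = ∑_{g ∈ (ℤ/2ℤ)^T} F(d_g)`**: sums over the divisors of `M_T` are sums over the sign group.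
[cite: Martin2018RefinedDimensions, §3 Prop. 12] -/
theorem sum_divisors_prod_eq_sum {α : Type*} [AddCommMonoid α] (F : ℕ → α) :
    ∑ d ∈ (∏ q ∈ T, q).divisors, F d = ∑ g : T → Multiplicative (ZMod 2), F (divisorOf T g) := by
  classical
  symm
  refine Finset.sum_nbij (divisorOf T) (fun g _ => divisorOf_mem_divisors T hN hT g)
    (fun g _ g' _ h => divisorOf_injective T hT h) (fun d hd => ?_) fun _ _ => rfl
  obtain ⟨g, hg⟩ := exists_divisorOf_eq T hN hT (Nat.mem_divisors.mp (Finset.mem_coe.mp hd)).1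
  exact ⟨g, Finset.mem_coe.mpr (Finset.mem_univ g), hg⟩

include hT in
/-- The sign character as a function of the divisor: `χ(g) = ∏_{q ∈ T, q ∣ d_g} χ_q`. [cite: Martin2018RefinedDimensions, §3 (`ε_M(d) = ∏_{p ∣ d} ε_p`)] -/
theorem signCharacter_eq_prod_dvd_divisorOf (χ : T → ℤˣ) (g : T → Multiplicative (ZMod 2)) :
    signCharacter T χ g = ∏ r : T, if (r : ℕ) ∣ divisorOf T g then χ r else 1 := by
  rw [signCharacter_apply]
  refine Finset.prod_congr rfl fun r _ => ?_
  by_cases h : g r = 1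
  · rw [if_pos h, if_neg (fun h' => (dvd_divisorOf_iff T hT g r).mp h' h)]
  · rw [if_neg h, if_pos ((dvd_divisorOf_iff T hT g r).mpr h)]

end Divisors

/-! ## §2 The dimension formula over the divisors of `M_T` -/

variable {Nplus Nminus : ℕ} (S : XiSetup Nplus Nminus) {T : Finset ℕ} (hT : T ⊆ Nminus.primeFactors)
include hT

/-- **`2^{#T} · dim M^χ(O) = ∑_{d ∣ M_T} χ(d) · #{c ∈ Cls O : O_L(I_c) ∋ x, nrd x = d}`**, `χ(d) = ∏_{q ∈ T, q ∣ d} χ_q`, for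
every set `T` of primes of the discriminant, every sign pattern `χ` and every Eichler order `O` of level `N⁺` — Martin's
Proposition 12 in its printed shape `2^{−ω(M)} ∑_{d ∣ M} ε_M(d) tr W_d`, with Eichler's traces.
[cite: Martin2018RefinedDimensions, §3 Prop. 12] [cite: VignerasLNM800, Ch. V §2] [cite: Voight2021, (30.9.3)] -/
theorem XiSetup.two_pow_mul_finrank_signSpace_eq_sum_divisors (χ : T → ℤˣ) :
    (2 : ℚ) ^ T.card * Module.finrank ℚ (S.signSpace T χ) =
      ∑ d ∈ (∏ q ∈ T, q).divisors, (∏ r : T, if (r : ℕ) ∣ d then ((χ r : ℤ) : ℚ) else 1) *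
        Nat.card {c : ClassSet S.O // ∃ x ∈ leftOrder c.rep, reducedNorm ℚ S.D x = (d : ℕ)} := by
  rw [S.two_pow_mul_finrank_signSpace_eq_sum_natCard_represents hT χ, sum_divisors_prod_eq_sum T S.squarefree hT]
  refine Finset.sum_congr rfl fun g _ => ?_
  rw [signCharacter_eq_prod_dvd_divisorOf T hT χ g, Units.coe_prod, Int.cast_prod]
  congr 1
  refine Finset.prod_congr rfl fun r _ => ?_
  split_ifs <;> simp

/-- **`2^{#T} · h_T = ∑_{d ∣ M_T} #{c ∈ Cls O : O_L(I_c) ∋ x, nrd x = d}`**: Martin's `T`-ideal class number by norm counts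
over the divisors of `M_T` (at `T` = all primes of `N⁻`, `N⁺ = 1`: `two_pow_mul_natCard_typeSet_eq_sum_natCard`).
[cite: Martin2018, §2 (`h_{B,S}`) and (3.9)] [cite: Voight2021, (30.9.3)] -/
theorem XiSetup.two_pow_mul_natCard_sClassSet_eq_sum_divisors :
    2 ^ T.card * Nat.card (S.SClassSet T) =
      ∑ d ∈ (∏ q ∈ T, q).divisors, Nat.card {c : ClassSet S.O // ∃ x ∈ leftOrder c.rep, reducedNorm ℚ S.D x = (d : ℕ)} := by
  rw [S.two_pow_mul_natCard_sClassSet_eq_sum_natCard_represents hT,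
    sum_divisors_prod_eq_sum T S.squarefree hT fun d =>
      Nat.card {c : ClassSet S.O // ∃ x ∈ leftOrder c.rep, reducedNorm ℚ S.D x = (d : ℕ)}]

/-! ## §3 The equidistribution criterion -/

omit hT in
/-- A count over `Cls O` vanishes iff the counted property never holds. [folklore] -/
private theorem natCard_subtype_eq_zero_iff (P : ClassSet S.O → Prop) : Nat.card {c : ClassSet S.O // P c} = 0 ↔ ∀ c, ¬ P c := by
  rw [Nat.card_eq_zero, isEmpty_subtype, or_iff_left (not_infinite_iff_finite.mpr inferInstance)]

omit hT in
/-- `dim M^χ(O)` independent of `χ` iff `2^{#T} dim M^χ(O) = h` for all `χ`. [cite: Martin2018, §4.4 Cor. 8] -/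
theorem XiSetup.forall_finrank_signSpace_eq_iff_forall_two_pow_mul (T : Finset ℕ) :
    (∀ χ χ' : T → ℤˣ, Module.finrank ℚ (S.signSpace T χ) = Module.finrank ℚ (S.signSpace T χ')) ↔
      ∀ χ : T → ℤˣ, (2 : ℚ) ^ T.card * Module.finrank ℚ (S.signSpace T χ) = Nat.card (ClassSet S.O) := by
  constructor
  · intro h χ
    exact_mod_cast S.two_pow_mul_finrank_signSpace_eq_of_forall_finrank_eq T h χ
  · intro h χ χ'
    have e := (h χ).trans (h χ').symm
    have h2 : (2 : ℚ) ^ T.card ≠ 0 := pow_ne_zero _ two_ne_zero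
    exact_mod_cast mul_left_cancel₀ h2 e

/-- **Equidistribution criterion.** For a set `T` of primes of the discriminant `N⁻`, the following are equivalent:
(i) `dim M^χ(O)` is the same for all `2^{#T}` sign patterns `χ` for `T` (equivalently, Cor. 8: every `T`-class is
`χ`-admissible for every `χ`); (ii) for every divisor `d > 1` of `M_T = ∏_{q ∈ T} q`, no left order `O_L(I_c)`,
`[I_c] ∈ Cls O`, contains an element of reduced norm `d` (the involutions `∏_{q ∣ d} W_q` act without fixed class).
[cite: Martin2018, §4.4 Cor. 8 and §4.5] [cite: Martin2018RefinedDimensions, §3 Prop. 12] [cite: Voight2021, (30.9.3)] -/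
theorem XiSetup.forall_finrank_signSpace_eq_iff_forall_not_exists_reducedNorm :
    (∀ χ χ' : T → ℤˣ, Module.finrank ℚ (S.signSpace T χ) = Module.finrank ℚ (S.signSpace T χ')) ↔
      ∀ d ∈ (∏ q ∈ T, q).divisors, d ≠ 1 →
        ∀ c : ClassSet S.O, ¬ ∃ x ∈ leftOrder c.rep, reducedNorm ℚ S.D x = (d : ℕ) := by
  rw [S.forall_finrank_signSpace_eq_iff_forall_two_pow_mul T, S.forall_finrank_signSpace_eq_iff_forall_fixedPoints T]
  constructor
  · intro h d hd hd1 c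
    obtain ⟨g, rfl⟩ := exists_divisorOf_eq T S.squarefree hT (Nat.mem_divisors.mp hd).1
    have hg : g ≠ 1 := fun hg => hd1 (by rw [hg, divisorOf_one])
    have h0 := h g hg
    rw [S.natCard_fixedPoints_atkinLehnerHom_eq_natCard_represents hT g, natCard_subtype_eq_zero_iff] at h0
    exact h0 c
  · intro h g hg
    rw [S.natCard_fixedPoints_atkinLehnerHom_eq_natCard_represents hT g, natCard_subtype_eq_zero_iff]
    refine h _ (divisorOf_mem_divisors T S.squarefree hT g) fun h1 => hg ?_
    exact divisorOf_injective T hT (h1.trans (divisorOf_one T).symm)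

/-- Under the criterion, **`2^{#T} · dim M^χ(O) = h` for every `χ`**. [cite: Martin2018, §4.4 Cor. 8] -/
theorem XiSetup.finrank_signSpace_mul_two_pow_eq_of_forall_not_exists_reducedNorm
    (h : ∀ d ∈ (∏ q ∈ T, q).divisors, d ≠ 1 → ∀ c : ClassSet S.O, ¬ ∃ x ∈ leftOrder c.rep, reducedNorm ℚ S.D x = (d : ℕ))
    (χ : T → ℤˣ) : 2 ^ T.card * Module.finrank ℚ (S.signSpace T χ) = Nat.card (ClassSet S.O) :=
  S.two_pow_mul_finrank_signSpace_eq_of_forall_finrank_eq T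
    ((S.forall_finrank_signSpace_eq_iff_forall_not_exists_reducedNorm hT).mpr h) χ

/-- Under the criterion, **`2^{#T} · h_T = h`** (every `T`-class has `2^{#T}` members). [cite: Martin2018, §2 and §4.5] -/
theorem XiSetup.natCard_sClassSet_mul_two_pow_eq_of_forall_not_exists_reducedNorm
    (h : ∀ d ∈ (∏ q ∈ T, q).divisors, d ≠ 1 → ∀ c : ClassSet S.O, ¬ ∃ x ∈ leftOrder c.rep, reducedNorm ℚ S.D x = (d : ℕ)) :
    2 ^ T.card * Nat.card (S.SClassSet T) = Nat.card (ClassSet S.O) := by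
  rw [← S.finrank_signSpace_one_eq_natCard_sClassSet T]
  exact S.finrank_signSpace_mul_two_pow_eq_of_forall_not_exists_reducedNorm hT h 1

end Brandt

end Literature.NumberTheory.Automorphic
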